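/-
Copyright (c) 2026. All rights reserved.
Released under Apache 2.0 license as described in the file LICENSE.
Authors: abc-iut cell, F-wave seat abc-iut-f-101 (gen 6), over abc-iut-w6-d025 / abc-iut-L4-t8's sum of `⋉`-carriers,
abc-iut-L4-t6's archimedean carrier of record, abc-iut-L4-t11's `IotaOver` transfers and this seat's observables over `⋉`.
-/
import Literature.AnabelianGeometry.AbsoluteAnabelian.Ltimes.LogFrobeniusSettingSumObservables
import Literature.AnabelianGeometry.AbsoluteAnabelian.Ltimes.LogFrobeniusSettingSumTS
import Literature.AnabelianGeometry.AbsoluteAnabelian.Ltimes.LogFrobeniusArchGenuinePlusTS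
import HarnessLib

/-!
# [AbsTopIII] Cor 5.10 (iv)(b), last sentence, over the `⋉`-successor AT THE TWO-SIDED SETTING OF RECORD

S. Mochizuki, *Topics in absolute anabelian geometry III*, J. Math. Sci. Univ. Tokyo 22 (2015) [MochizukiAbsTopIII2015],
Cor 5.10 (iv)(b) pp. 147–148: «… Moreover, the respective family of homotopies of `𝔗_{An⊢}` and the observables `S_log`,
`S_log⊞` of Cor 5.5 (iii) are compatible.»; Cor 5.5 p. 130 (the proviso `λ⊞_{space-link} = λ⊞_{post-log}`), Rmk 3.5.1 p. 78.

Cell slice T9-E «OBS@⋉-CARRIERS», last piece of M1 (iii) (L4-lead m187/m191): this seat's sufficiency theorem over `⋉`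
(`LogFrobeniusSettingLtimes.cor510MonoTelecoreObservablesCompatible_of`) at the SETTING OF RECORD
`genuineTwoSidedSumLtimes p 𝔄 V₁ V₂ = (genuineOpen p V₁).toLtimes.sum (archGenuinePlus 𝔄 V₂ _)`:

* §2 the over-`Th•[Z]` bridges at the sum (`hoverPlus` / `hoverTS` of the sufficiency theorem) from this seat's
  `Ltimes/…OverGenerators` / `…TSOverGenerators` and `Ltimes/…OverBridge(TS)`, with `IotaOver` of the sum BY NAME (abc-iut-L4-t11's
  `genuineTwoSidedSumLtimes_iotaOver`) and `LamOverLink` of the sum (`Ltimes/LogFrobeniusSettingSumObservables`), and, for the `TS` side, a `TS`-datum on the sum whose `ι` lie over `Th•[Z]` (`TS.IotaOverTS`);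
* §3 ★★ `genuineTwoSidedSumLtimes_cor510MonoTelecoreObservablesCompatible_of_iotaOverTS [Nonempty (V₁ ⊕ V₂)] (c hc hcob) (TS) (hT)` —
  Cor 5.10 (iv)(b)'s observable clause AT THE SETTING OF RECORD under the orientation cochain of `𝔄`, for every `TS`-datum on the
  sum with `IotaOverTS`, the summand-wise coherence data of abc-iut-L4-t8's carrier file (`….hN`, `….hψ`) and this seat's
  (α) structures (`genuineTwoSidedSumLtimes_cor55Observables(TS)`, as the universal families) fed BY NAME; `_iff_nonempty`.

* §4 ★★★ THE COUNTED FORM: the sum's own `TS`-datum `genuineTwoSidedSumLtimesTS` (`TSHomotopies.sum` of the restricted frozen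
  genuine `TS`-datum and `archGenuinePlusTS`), its `IotaOverTS` (`iotaOverTS_sum`), and
  `genuineTwoSidedSumLtimes_cor510MonoTelecoreObservablesCompatible [Nonempty (V₁ ⊕ V₂)] (c hc hcob)` — binders beyond
  `V₁ ⊕ V₂ ≠ ∅` = the orientation cochain ALONE (L4-lead m214's count standard); `_iff`, `∃`-form.
BINDERS REMAINING (honest): the orientation cochain `(c, hc, hcob)` only (NECESSARY at general `𝔄`, abc-iut-w5-d038).  MODEL-LEVEL (a carrier of OUR successor typing); refereed pre-IUT
material; nothing here bears on [IUTchIII] Cor. 3.12; no side taken; instantiated ≠ endorsed; typed ≠ proved.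
-/

set_option autoImplicit false

universe u

open CategoryTheory Quiver

namespace Literature.AnabelianGeometry.AbsoluteAnabelian

namespace LogFrobeniusSettingLtimes

/-! ## §2. At the setting of record -/

section TwoSided

open LogFrobeniusSetting AbsTopIII DiagramOfCategories

variable (p : ℕ) [Fact p.Prime] (𝔄 : AutHolFieldFunctor.{0}) (V₁ V₂ : Type 1)

/-- **`hoverPlus` at the setting of record**, GIVEN `IotaOver` of the sum: every homotopy of the universal `⊞`-observable family,
read inside `D_{An⊢}`, lies over the core for the summand-wise mono-telecore over-datum (`K.hN`, `K.hψ` of abc-iut-L4-t8's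
coherence datum). [cite: MochizukiAbsTopIII2015, Remark 3.5.1 p.78] -/
theorem genuineTwoSidedSumLtimes_isOver_embPlusHom (c : 𝔄.EA → ℝ) (hc : ∀ X : 𝔄.EA, c X = 1 ∨ c X = -1)
    (hcob : ∀ {X Y : 𝔄.EA} (f : X ⟶ Y), AutHolFieldFunctor.transitionSign f = c X * c Y)
    (v : V₁ ⊕ V₂)
    (a : (LogFrobeniusSettingLtimes.logShapePlus (isArc := Sum.elim (fun _ : V₁ => false) (fun _ : V₂ => true)) v).Vertex)
    (q r : Path a (LogFrobeniusSettingLtimes.logShapePlus (isArc := Sum.elim (fun _ : V₁ => false) (fun _ : V₂ => true)) v).obs)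
    (h : ((genuineTwoSidedSumLtimes p 𝔄 V₁ V₂).logObsFamily v
      (genuineTwoSidedSumLtimes_iotaSquaresCommute p 𝔄 V₁ V₂ v)).E q r) :
    ((genuineTwoSidedSumLtimes p 𝔄 V₁ V₂).monoTeleOver
        (genuineTwoSidedSumLtimes_monoTelecoreCoherence p 𝔄 V₁ V₂ c hc hcob).hN
        (genuineTwoSidedSumLtimes_monoTelecoreCoherence p 𝔄 V₁ V₂ c hc hcob).hψ).IsOver
      ((LogFrobeniusSettingLtimes.embMonoPlus (monoJ (Vmod := V₁ ⊕ V₂)) v).mapPath q)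
      ((LogFrobeniusSettingLtimes.embMonoPlus (monoJ (Vmod := V₁ ⊕ V₂)) v).mapPath r)
      ((genuineTwoSidedSumLtimes p 𝔄 V₁ V₂).embPlusHom v
        ((genuineTwoSidedSumLtimes p 𝔄 V₁ V₂).logObsFamily v
          (genuineTwoSidedSumLtimes_iotaSquaresCommute p 𝔄 V₁ V₂ v)) h) :=
  (genuineTwoSidedSumLtimes p 𝔄 V₁ V₂).isOver_embPlusHom_of_isOver _ _ v _
    (fun h' => (genuineTwoSidedSumLtimes p 𝔄 V₁ V₂).isOver_logObsFamily_η_map v (genuineTwoSidedSumLtimes_iotaOver p 𝔄 V₁ V₂)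
      (genuineTwoSidedSumLtimes_lamOverLink p 𝔄 V₁ V₂) _ _ h') a q r h

/-- **`hoverTS` at the setting of record**, for a `TS`-datum on the sum whose `ι` lie over `Th•[Z]`.
[cite: MochizukiAbsTopIII2015, Remark 3.5.1 p.78] -/
theorem genuineTwoSidedSumLtimes_isOver_embTSHom (c : 𝔄.EA → ℝ) (hc : ∀ X : 𝔄.EA, c X = 1 ∨ c X = -1)
    (hcob : ∀ {X Y : 𝔄.EA} (f : X ⟶ Y), AutHolFieldFunctor.transitionSign f = c X * c Y)
    (TS : (genuineTwoSidedSumLtimes p 𝔄 V₁ V₂).TSHomotopies) (hT : TS.IotaOverTS) (v : V₁ ⊕ V₂)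
    (a : (logShapeTS (isArc := Sum.elim (fun _ : V₁ => false) (fun _ : V₂ => true)) v).Vertex)
    (q r : Path a (logShapeTS (isArc := Sum.elim (fun _ : V₁ => false) (fun _ : V₂ => true)) v).obs)
    (h : ((genuineTwoSidedSumLtimes p 𝔄 V₁ V₂).logObsFamilyTS v TS
      (genuineTwoSidedSumLtimes_iotaSquaresCommuteTS p 𝔄 V₁ V₂ TS v)).E q r) :
    ((genuineTwoSidedSumLtimes p 𝔄 V₁ V₂).monoTeleOver
        (genuineTwoSidedSumLtimes_monoTelecoreCoherence p 𝔄 V₁ V₂ c hc hcob).hN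
        (genuineTwoSidedSumLtimes_monoTelecoreCoherence p 𝔄 V₁ V₂ c hc hcob).hψ).IsOver
      ((embMonoTS (monoJ (Vmod := V₁ ⊕ V₂)) v).mapPath q) ((embMonoTS (monoJ (Vmod := V₁ ⊕ V₂)) v).mapPath r)
      ((genuineTwoSidedSumLtimes p 𝔄 V₁ V₂).embTSHom v
        ((genuineTwoSidedSumLtimes p 𝔄 V₁ V₂).logObsFamilyTS v TS
          (genuineTwoSidedSumLtimes_iotaSquaresCommuteTS p 𝔄 V₁ V₂ TS v)) h) :=
  (genuineTwoSidedSumLtimes p 𝔄 V₁ V₂).isOver_embTSHom_of_isOver _ _ v _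
    (fun h' => (genuineTwoSidedSumLtimes p 𝔄 V₁ V₂).isOver_logObsFamilyTS_η_map v TS hT
      (genuineTwoSidedSumLtimes_lamOverLink p 𝔄 V₁ V₂) _ _ h') a q r h

/-! ## §3. Cor 5.10 (iv)(b), «compatible with `S_log`, `S_log⊞`», at the setting of record -/

/-- ★★ **Cor 5.10 (iv)(b), «the family of homotopies of `𝔗_{An⊢}` and the observables `S_log`, `S_log⊞` are compatible», AT THE
TWO-SIDED `⋉`-CARRIER OF RECORD `genuineTwoSidedSumLtimes p 𝔄 V₁ V₂`** (`V₁ ⊕ V₂ ≠ ∅`), under the orientation cochain of `𝔄`,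
GIVEN a `TS`-datum on it whose `ι` lie over `Th•[Z]` (`IotaOver` of the sum by name): ONE family of homotopies on `D_{An⊢}` contains
the telecore family `𝒥` of the summand-wise `𝔗_{An⊢}` and the embedded observables `S_log⊞_v`, `S_log_v` at EVERY place of BOTH
kinds — this seat's sufficiency theorem over `⋉`, the coherence data of abc-iut-L4-t8's carrier file and this seat's (α)
structures fed BY NAME. [cite: MochizukiAbsTopIII2015, Cor 5.10 (iv)(b) p. 147] -/
theorem genuineTwoSidedSumLtimes_cor510MonoTelecoreObservablesCompatible_of_iotaOverTS [Nonempty (V₁ ⊕ V₂)] (c : 𝔄.EA → ℝ)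
    (hc : ∀ X : 𝔄.EA, c X = 1 ∨ c X = -1)
    (hcob : ∀ {X Y : 𝔄.EA} (f : X ⟶ Y), AutHolFieldFunctor.transitionSign f = c X * c Y)
    (TS : (genuineTwoSidedSumLtimes p 𝔄 V₁ V₂).TSHomotopies) (hT : TS.IotaOverTS) :
    (genuineTwoSidedSumLtimes p 𝔄 V₁ V₂).Cor510MonoTelecoreObservablesCompatible TS :=
  (genuineTwoSidedSumLtimes p 𝔄 V₁ V₂).cor510MonoTelecoreObservablesCompatible_of
    (TS := TS)
    (hN := (genuineTwoSidedSumLtimes_monoTelecoreCoherence p 𝔄 V₁ V₂ c hc hcob).hN)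
    (hψ := (genuineTwoSidedSumLtimes_monoTelecoreCoherence p 𝔄 V₁ V₂ c hc hcob).hψ)
    (Hplus := fun v => (genuineTwoSidedSumLtimes p 𝔄 V₁ V₂).logObsFamily v
      (genuineTwoSidedSumLtimes_iotaSquaresCommute p 𝔄 V₁ V₂ v))
    (Hts := fun v => (genuineTwoSidedSumLtimes p 𝔄 V₁ V₂).logObsFamilyTS v TS
      (genuineTwoSidedSumLtimes_iotaSquaresCommuteTS p 𝔄 V₁ V₂ TS v))
    (hpush := fun v => (genuineTwoSidedSumLtimes p 𝔄 V₁ V₂).subFamily_pushFamily_logObsFamilyTS v TS _ _)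
    (hoverPlus := fun v a q r h => genuineTwoSidedSumLtimes_isOver_embPlusHom p 𝔄 V₁ V₂ c hc hcob v a q r h)
    (hoverTS := fun v a q r h => genuineTwoSidedSumLtimes_isOver_embTSHom p 𝔄 V₁ V₂ c hc hcob TS hT v a q r h)
    (hobs := fun v => genuineTwoSidedSumLtimes_isLogObservable_pair p 𝔄 V₁ V₂ TS v)

/-- … and, given the same inputs, the clause holds at the setting of record EXACTLY iff `V₁ ⊕ V₂ ≠ ∅`.
[cite: MochizukiAbsTopIII2015, Cor 5.10 (iv)(b) p. 147] -/
theorem genuineTwoSidedSumLtimes_cor510MonoTelecoreObservablesCompatible_iff_nonempty (c : 𝔄.EA → ℝ)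
    (hc : ∀ X : 𝔄.EA, c X = 1 ∨ c X = -1)
    (hcob : ∀ {X Y : 𝔄.EA} (f : X ⟶ Y), AutHolFieldFunctor.transitionSign f = c X * c Y)
    (TS : (genuineTwoSidedSumLtimes p 𝔄 V₁ V₂).TSHomotopies) (hT : TS.IotaOverTS) :
    (genuineTwoSidedSumLtimes p 𝔄 V₁ V₂).Cor510MonoTelecoreObservablesCompatible TS ↔ Nonempty (V₁ ⊕ V₂) := by
  refine ⟨fun h => ?_, fun _ =>
    genuineTwoSidedSumLtimes_cor510MonoTelecoreObservablesCompatible_of_iotaOverTS p 𝔄 V₁ V₂ c hc hcob TS hT⟩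
  by_contra hne
  haveI : IsEmpty (V₁ ⊕ V₂) := not_nonempty_iff.mp hne
  exact (genuineTwoSidedSumLtimes p 𝔄 V₁ V₂).not_cor510MonoTelecoreObservablesCompatible_of_isEmpty _ h


/-! ## §4. The COUNTED form: the sum's own `TS`-datum (binders = the orientation cochain only) -/

/-- ★ **the `TS`-datum of record on the two-sided `⋉`-carrier**: the frozen genuine `TS`-datum at `p` restricted along `toLtimes`
(abc-iut-w5-d053/L4-t11) ⊕ `archGenuinePlusTS` at the archimedean places, glued by `TSHomotopies.sum`.
[cite: MochizukiAbsTopIII2015, Def 5.4 (vii) p. 128] -/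
noncomputable def genuineTwoSidedSumLtimesTS : (genuineTwoSidedSumLtimes p 𝔄 V₁ V₂).TSHomotopies :=
  TSHomotopies.sum _ _ ((genuineOpenTS p V₁).toLtimes) (archGenuinePlusTS 𝔄 V₂ (fun _ => true))

/-- its `ι` lie over `Th•[Z]` (summand-wise: `genuineOpenTS_iotaOverTS` transferred along `toLtimes`, `archGenuinePlus_iotaOverTS`;
glued by `iotaOverTS_sum` with the two «`logIsoId` over `logOver`» facts of abc-iut-L4-t11).
[cite: MochizukiAbsTopIII2015, Def 5.4 (vii) p. 128] -/
theorem genuineTwoSidedSumLtimesTS_iotaOverTS : (genuineTwoSidedSumLtimesTS p 𝔄 V₁ V₂).IotaOverTS :=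
  iotaOverTS_sum _ _ (LogFrobeniusSetting.TSHomotopies.IotaOverTS.toLtimes _ (genuineOpenTS_iotaOverTS p V₁))
    (archGenuinePlus_iotaOverTS 𝔄 V₂ (fun _ => true)) (openLtimes_proj_map_logIsoId p V₁)
    (archGenuinePlus_proj_map_logIsoId 𝔄 V₂ (fun _ => true))

/-- ★★★ **Cor 5.10 (iv)(b), last sentence («the family of homotopies of `𝔗_{An⊢}` and the observables `S_log`, `S_log⊞` are
compatible»), AT THE TWO-SIDED `⋉`-SETTING OF RECORD with its own `TS`-datum — the COUNTED form: binders beyond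
`V₁ ⊕ V₂ ≠ ∅` = the orientation cochain of `𝔄` ALONE** (NECESSARY at general `𝔄`, abc-iut-w5-d038; Rmk 5.8.1 (i)).
[cite: MochizukiAbsTopIII2015, Cor 5.10 (iv)(b) p. 147] -/
theorem genuineTwoSidedSumLtimes_cor510MonoTelecoreObservablesCompatible [Nonempty (V₁ ⊕ V₂)] (c : 𝔄.EA → ℝ)
    (hc : ∀ X : 𝔄.EA, c X = 1 ∨ c X = -1)
    (hcob : ∀ {X Y : 𝔄.EA} (f : X ⟶ Y), AutHolFieldFunctor.transitionSign f = c X * c Y) :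
    (genuineTwoSidedSumLtimes p 𝔄 V₁ V₂).Cor510MonoTelecoreObservablesCompatible (genuineTwoSidedSumLtimesTS p 𝔄 V₁ V₂) :=
  genuineTwoSidedSumLtimes_cor510MonoTelecoreObservablesCompatible_of_iotaOverTS p 𝔄 V₁ V₂ c hc hcob _
    (genuineTwoSidedSumLtimesTS_iotaOverTS p 𝔄 V₁ V₂)

/-- … EXACTLY iff `V₁ ⊕ V₂ ≠ ∅` (under the cochain). [cite: MochizukiAbsTopIII2015, Cor 5.10 (iv)(b) p. 147] -/
theorem genuineTwoSidedSumLtimes_cor510MonoTelecoreObservablesCompatible_iff (c : 𝔄.EA → ℝ)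
    (hc : ∀ X : 𝔄.EA, c X = 1 ∨ c X = -1)
    (hcob : ∀ {X Y : 𝔄.EA} (f : X ⟶ Y), AutHolFieldFunctor.transitionSign f = c X * c Y) :
    (genuineTwoSidedSumLtimes p 𝔄 V₁ V₂).Cor510MonoTelecoreObservablesCompatible (genuineTwoSidedSumLtimesTS p 𝔄 V₁ V₂) ↔
      Nonempty (V₁ ⊕ V₂) :=
  genuineTwoSidedSumLtimes_cor510MonoTelecoreObservablesCompatible_iff_nonempty p 𝔄 V₁ V₂ c hc hcob _
    (genuineTwoSidedSumLtimesTS_iotaOverTS p 𝔄 V₁ V₂)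

/-- ∃-form under the cochain: the two-sided `⋉`-setting of record CARRIES a `TS`-datum whose `ι` lie over `Th•[Z]` and for which
Cor 5.10 (iv)(b)'s observable clause holds. [cite: MochizukiAbsTopIII2015, Cor 5.10 (iv)(b) p. 147] -/
theorem genuineTwoSidedSumLtimes_exists_TS_cor510MonoTelecoreObservablesCompatible [Nonempty (V₁ ⊕ V₂)] (c : 𝔄.EA → ℝ)
    (hc : ∀ X : 𝔄.EA, c X = 1 ∨ c X = -1)
    (hcob : ∀ {X Y : 𝔄.EA} (f : X ⟶ Y), AutHolFieldFunctor.transitionSign f = c X * c Y) :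
    ∃ TS : (genuineTwoSidedSumLtimes p 𝔄 V₁ V₂).TSHomotopies,
      TS.IotaOverTS ∧ (genuineTwoSidedSumLtimes p 𝔄 V₁ V₂).Cor510MonoTelecoreObservablesCompatible TS :=
  ⟨_, genuineTwoSidedSumLtimesTS_iotaOverTS p 𝔄 V₁ V₂,
    genuineTwoSidedSumLtimes_cor510MonoTelecoreObservablesCompatible p 𝔄 V₁ V₂ c hc hcob⟩

end TwoSided

end LogFrobeniusSettingLtimes

end Literature.AnabelianGeometry.AbsoluteAnabelian
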